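import Summits.Ventures.MM22.Rank333.WangTop333Data
import HarnessLib

/-!
# MM22 venture, Route D3 — Wang's `⟨3,3,3⟩` certificate over `𝔽₂`, top layers: CHECKS of orbit `[1]` (index 17), lookup-table part 1

HONEST FRAMING (cell `pub-mm22`, seat p3, Route D3). Kernel replay (`decide +kernel`, axioms standard) of the TOP
LAYERS of Wang's certificate for `20 ≤ R_{𝔽₂}(⟨3,3,3⟩)` (arXiv:2603.07280, `cert_matrix_q02_n333`): the unconstrained
orbit (bound 20, 511 DFS leaves) and the codimension-1 orbits `[1]`, `[10]`, `[84]` (bound 19; 396 + 255 + 255 leaves),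
each justified by one lookup and one DFS round whose every leaf is looked up, through an explicit sandwich
`X ↦ P X Q` (and the transpose transport of `GF2CertTransport.lean` for three twin orbits), in the table of
deeper orbits. The fourteen codimension-2 orbit bounds of the certificate are HYPOTHESES (each the statement
`Cert 3 3 3 K b`: every bilinear computation over `𝔽₂` of `(X, Y) ↦ X Y` restricted to
`X ∈ S_K = {X : κ(X) = 0, κ ∈ K}` has at least `b` products), so the end theorem
`rankGe20F2_of_codim2Bounds` (file `WangTop333Cert.lean`) is CONDITIONAL; nothing in these files proves `RankGe20F2`.
Data: `WangTop333Data.lean`; checker: `Summits/MatrixMultiplication/OmegaCensus/SmallFormats/GF2OrbitSweep.lean`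
(cell `pub-omega`) with `GF2OrbitSplit.lean`; assembly: `GF2CertTransport.lean` (`sweepJ`).

This file: lookup-table chunks [0, 1, 2] of orbit 17 (`K = [1]`, Wang's index 492): every entry points backwards and its
sandwich `X ↦ P X Q` maps the source orbit's subspace into `S_{K ++ extra}` (checked on all `512` bit patterns).
-/

namespace Summit.Ventures.MM22.GF2Cert.Top333

open Summit.MatrixMultiplication.OmegaCensus.GF2RankLB Literature.Computability.AlgebraicComplexity
open Summit.Ventures.MM22.GF2Cert

/-- Lookup-table chunk 0 of orbit 17: every entry points backwards and its sandwich is valid. -/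
theorem t492_0_ok : tableOK 3 3 os 17 [1] c492 t492_0 = true := by decide +kernel

/-- Lookup-table chunk 1 of orbit 17: every entry points backwards and its sandwich is valid. -/
theorem t492_1_ok : tableOK 3 3 os 17 [1] c492 t492_1 = true := by decide +kernel

/-- Lookup-table chunk 2 of orbit 17: every entry points backwards and its sandwich is valid. -/
theorem t492_2_ok : tableOK 3 3 os 17 [1] c492 t492_2 = true := by decide +kernel

end Summit.Ventures.MM22.GF2Cert.Top333
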